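import Summits.Schanuel.Schanuel.Theorems.DiophantineDichotomyApproximationPropertyDefs
import Literature.Combinatorics.Extremal.LowDegreeSurfaceThroughLines
import Literature.FieldTheory.QuasiAlgClosed.Basic
import Mathlib.RingTheory.MvPolynomial.Homogeneous
import Mathlib.Algebra.CharZero.Infinite
import HarnessLib

/-!
# Bézout for a line against a hypersurface (stub `form_vanishes_on_line`)

Route `DiophantineDichotomy`, crux `ApproximationProperty` (stmt-Schanuel-6117), line
`orbit-interpolation-determinant`, registered stub `form_vanishes_on_line` (lead c2, wave 1).

**Statement.** Let `F` be a form (homogeneous polynomial) of degree `d` in `m + 1` variables over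
`ℂ`, and let `p q : Fin (m + 1) → ℂ` span a (possibly degenerate) line `{a • p + b • q}`. If `F`
vanishes at `N > d` points `uᵢ • p + vᵢ • q` whose parameters `(uᵢ : vᵢ)` are pairwise
non-proportional (`uᵢ vₖ ≠ uₖ vᵢ` for `i ≠ k`), then `F` vanishes at every point `a • p + b • q`.

**Proof.** Elementary: after a shear `p' := p - l • q` of the parametrisation, chosen so that no
zero and not the target point lies "at infinity" (`vᵢ + l uᵢ ≠ 0`, `b + l a ≠ 0`; possible since `ℂ`
is infinite and no zero is the origin once `N ≥ 2`), homogeneity (`F (c • x) = c ^ d F x`,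
`MvPolynomial.IsHomogeneous.eval_smul_eq`) moves
all `N` zeros to pairwise distinct parameters `t` of the affine line `q + t • p'`; the restriction
of `F` to that affine line is a univariate polynomial of degree `≤ d` with `N > d` roots, hence zero
(`Literature.Combinatorics.Extremal.aeval_line_eq_zero_of_totalDegree_lt_card`, Bézout on a line),
and the target point is `(b + l a) • (q + t₀ • p')`. The case `d = 0` (constant `F`) is separate.

Pure algebra over `ℂ`; no project definitions are involved (the `Defs` import only fixes the
namespace context of the line).
-/

-- `Summit.Schanuel.Schanuel.…` is the mandated summit/sub-problem namespace (single-conjunct summit), hence: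
set_option linter.dupNamespace false

noncomputable section

namespace Summit.Schanuel.Schanuel.Cruxes.ApproximationProperty.OrbitInterpolationDeterminant

open MvPolynomial

/-- Affine Bézout on a line for a form: if a form `F` of degree `d` vanishes at the points
`q + t • p`, `t ∈ T`, for a finite set `T` of more than `d` parameters, then it vanishes at
`q + t • p` for every `t` (the restriction of `F` to the affine line is a univariate polynomial
of degree `≤ d` with more than `d` roots). -/
theorem eval_line_eq_zero_of_lt_card {σ : Type*} {F : MvPolynomial σ ℂ} {d : ℕ}
    (hF : F.IsHomogeneous d) (p q : σ → ℂ) (T : Finset ℂ) (hT : d < T.card)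
    (h0 : ∀ t ∈ T, MvPolynomial.eval (q + t • p) F = 0) (t : ℂ) :
    MvPolynomial.eval (q + t • p) F = 0 := by
  rw [← Literature.Combinatorics.Extremal.eval_aeval_line q p F t,
    Literature.Combinatorics.Extremal.aeval_line_eq_zero_of_totalDegree_lt_card q p F T
      (hF.totalDegree_le.trans_lt hT) h0, Polynomial.eval_zero]

/-- **Bézout for a line against a hypersurface** (registered stub `form_vanishes_on_line`).
A form `F` of degree `d` on `ℂ^{m+1}` having `N > d` zeros `uᵢ • p + vᵢ • q` on the line spanned
by `p, q`, with pairwise non-proportional parameters (`uᵢ vₖ ≠ uₖ vᵢ` for `i ≠ k`), vanishes at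
every point `a • p + b • q` of that line. -/
theorem form_vanishes_on_line : ∀ (m d N : ℕ) (F : MvPolynomial (Fin (m + 1)) ℂ)
    (p q : Fin (m + 1) → ℂ) (u v : Fin N → ℂ),
    F.IsHomogeneous d → (∀ i k, i ≠ k → u i * v k ≠ u k * v i) →
    (∀ i, MvPolynomial.eval (u i • p + v i • q) F = 0) → d < N →
    ∀ a b : ℂ, MvPolynomial.eval (a • p + b • q) F = 0 := by
  intro m d N F p q u v hF huv hzero hdN a b
  classical
  rcases Nat.eq_zero_or_pos d with hd | hd
  · -- `d = 0`: `F` evaluates constantly (`F x = F (0 • x) = F 0`), and `F` has a zero.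
    subst hd
    have hconst : ∀ x : Fin (m + 1) → ℂ, MvPolynomial.eval x F = MvPolynomial.eval 0 F := by
      intro x
      have h := hF.eval_smul_eq 0 x
      rw [zero_smul, pow_zero, one_mul] at h
      exact h.symm
    have i0 : Fin N := ⟨0, hdN⟩
    rw [hconst (a • p + b • q), ← hconst (u i0 • p + v i0 • q)]
    exact hzero i0
  · -- `0 < d < N`: no zero is the origin.
    have hne : ∀ i, u i ≠ 0 ∨ v i ≠ 0 := by
      intro i
      rcases ne_or_eq (u i) 0 with hu | hu
      · exact Or.inl hu
      rcases ne_or_eq (v i) 0 with hv | hv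
      · exact Or.inr hv
      exfalso
      haveI : Nontrivial (Fin N) := Fin.nontrivial_iff_two_le.mpr (by omega)
      obtain ⟨k, hk⟩ := exists_ne i
      exact huv k i hk (by rw [hu, hv, mul_zero, zero_mul])
    by_cases hab : a = 0 ∧ b = 0
    · -- the origin: `F 0 = 0 ^ d * F p = 0`.
      obtain ⟨rfl, rfl⟩ := hab
      have h0 : (0 : ℂ) • p + (0 : ℂ) • q = (0 : ℂ) • p := by simp
      rw [h0, hF.eval_smul_eq, zero_pow hd.ne', zero_mul]
    · -- shear parameter `l`: avoid the finitely many bad values.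
      obtain ⟨l, hl⟩ := Infinite.exists_notMem_finset
        (insert (-b / a) (Finset.univ.image fun i => -v i / u i))
      have hw : ∀ i, v i + l * u i ≠ 0 := by
        intro i h
        rcases eq_or_ne (u i) 0 with hu | hu
        · rcases hne i with h1 | h1
          · exact h1 hu
          · exact h1 (by simpa [hu] using h)
        · refine hl (Finset.mem_insert_of_mem (Finset.mem_image.mpr ⟨i, Finset.mem_univ _, ?_⟩))
          rw [div_eq_iff hu]
          linear_combination -h
      have hc : b + l * a ≠ 0 := by
        intro h
        rcases eq_or_ne a 0 with ha | ha
        · exact hab ⟨ha, by simpa [ha] using h⟩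
        · refine hl (Finset.mem_insert.mpr (Or.inl ?_))
          rw [eq_div_iff ha]
          linear_combination h
      -- the sheared direction `p'`; the line is `{c • (q + t • p')} ∪ {c • p'}`
      set p' : Fin (m + 1) → ℂ := p - l • q with hp'
      -- every zero lies in the affine chart `q + t • p'`, at parameter `uᵢ / (vᵢ + l uᵢ)`
      have hroot : ∀ i, MvPolynomial.eval (q + (u i / (v i + l * u i)) • p') F = 0 := by
        intro i
        have hinv : (v i + l * u i)⁻¹ * (v i + l * u i) = 1 := inv_mul_cancel₀ (hw i)
        have h1 : q + (u i / (v i + l * u i)) • p' = (v i + l * u i)⁻¹ • (u i • p + v i • q) := by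
          ext j
          simp only [hp', Pi.add_apply, Pi.smul_apply, Pi.sub_apply, smul_eq_mul, div_eq_mul_inv]
          linear_combination (-(q j)) * hinv
        rw [h1, hF.eval_smul_eq, hzero i, mul_zero]
      -- these parameters are pairwise distinct
      have hinj : Function.Injective fun i => u i / (v i + l * u i) := by
        intro i k hik
        by_contra hik'
        simp only at hik
        rw [div_eq_div_iff (hw i) (hw k)] at hik
        exact huv i k hik' (by linear_combination hik)
      have hT : d < (Finset.univ.image fun i => u i / (v i + l * u i)).card := by
        rw [Finset.card_image_of_injective _ hinj, Finset.card_univ, Fintype.card_fin]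
        exact hdN
      -- Bézout on the affine line: `F (q + t • p') = 0` for every `t`
      have hall := eval_line_eq_zero_of_lt_card hF p' q _ hT (fun t ht => by
        obtain ⟨i, _, rfl⟩ := Finset.mem_image.mp ht
        exact hroot i)
      -- the target point is `(b + l a) • (q + t₀ • p')`
      have hinv : (b + l * a)⁻¹ * (b + l * a) = 1 := inv_mul_cancel₀ hc
      have h3 : a • p + b • q = (b + l * a) • (q + (a / (b + l * a)) • p') := by
        ext j
        simp only [hp', Pi.add_apply, Pi.smul_apply, Pi.sub_apply, smul_eq_mul, div_eq_mul_inv]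
        linear_combination (l * a * q j - a * p j) * hinv
      rw [h3, hF.eval_smul_eq, hall, mul_zero]

end Summit.Schanuel.Schanuel.Cruxes.ApproximationProperty.OrbitInterpolationDeterminant

end
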